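import Literature.Analysis.DeBrangesSpaces.DeBranges1986Positivity
import Literature.Analysis.DeBrangesSpaces.DeBrangesPositivityProofs
import HarnessLib

/-!
# de Branges 1986, Theorems 6 and 7: proofs (structure functions without real zeros)

LABEL: RH-FREE. Proofs of CONDITIONAL theorems about a GENERAL de Branges structure function
`E`; the positivity condition is a HYPOTHESIS throughout (`DeBranges1986.ShiftNonneg`,
`DeBranges1986.ShiftPos`) and is never asserted for any `E` — for `E(z) = ξ(1 − iz)` it is
REFUTED (`Literature.Barriers.RiemannHypothesis.ConreyLi2000_HE_holds`). bears_on: B-C/B-P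
(LADDER-RH §1, COLUMN 6 DBR). WHAT THIS IS NOT: a statement about `ζ` or progress toward RH;
nothing here bears on the truth of RH.

We prove the statements of `DeBranges1986Positivity.lean` — de Branges, Bull. AMS 15 (1986),
Theorem 6 (p. 14 l. 41–45), the strict remark (p. 16 l. 17–20) and Theorem 7 (p. 16 l. 22–32)
— following the PRINTED proofs (pp. 15–16), for every structure function `E` with the
reproducing property `HasReproducing E` (`(F(t), K(w, t)) = F(w)`, p. 3 l. 22–25, for entire
`F` with `F/E ∈ L²(ℝ)` and the half-plane decay), in particular for every `E` WITHOUT REAL ZEROS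
(`hasReproducing_of_noRealZeros` = the tree's `deBrangesInner_deBrangesKernel`, Conrey–Li
(2.2)). This is the generality of Conrey–Li's Theorem 1 (`conreyLi2000_thm1_holds`) but WITHOUT
its monotonicity hypothesis, and with de Branges' stronger conclusions (simplicity; strict kernel
positivity; Theorem 7).

Architecture (de Branges p. 15–16, mirrored lemma by lemma):
* `HasKernelBound.exists_joint_bound`: the kernel bound `|F(z)|² ≤ ‖F‖² K(z, z)` gives
  `F/E, F♯/E = O(1/√(Im z))` on the upper half-plane, so EVERY element of the space is in the
  class of the reproducing identity; hence the space and the shift domain are closed under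
  `F ↦ F + μ G` (`Mem.add_mul`, `ShiftMem.add_mul`).
* `exists_shiftMem_kernel` (p. 15 l. 2–17): at a zero `w` with `w, w + i ∉ ℝ`, `K = K(w, ·)`
  is a nonzero element of the shift domain (`conj E(w + i) K(w, z + i) = −conj E(w − i)
  K(w + i, z)`), `(K(t + i), K(t)) = K(w, w + i)`, and for every `F` in the shift domain
  `(F(t + i), K(w, t)) + (F(t), K(w, t + i)) = ((E(w + i) − E(w − i))/E(w + i)) F(w + i)`.
* `shiftForm_eq_zero_of_re_eq_zero` (p. 16 l. 2–6, "by the Schwarz inequality"): if the form is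
  nonnegative on the shift domain and vanishes on `G`, then `[F, G] = 0` for all `F`.
* `exists_shiftMem_apply_ne_zero` (p. 16 l. 12–15, "iteration produces an element … such that
  `F(w + i)` is nonzero"; Conrey–Li's explicit `E♯(z)/(z − w − i)ⁿ`).
* `deBranges1986_thm6_of_hasReproducing`: `Re (K(t+i), K(t)) > 0` (else the two previous
  lemmas contradict each other), `= Re K(w, w + i)`, forcing `w̄ = w + i`, `E′(w) ≠ 0` and
  `Re conj E′(w) E(w + i)/(2πi) > 0`.
* `apply_add_I_ne_of_shiftPos`, `deBranges1986_strictRemark_of_noRealZeros`: the strict remark.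
* `deBranges1986_thm7_of_hasReproducing` (p. 16 l. 33–43): `Re (F(t+i), F(t)) = 0` forces
  `F(w + i) = 0` at admissible `w`, i.e. `F ⊥ K(w + i, ·) = −conj E(w + i)/(2πi) · E(z)/(z − w)`,
  so `F ⊥` the closed span and `F = 0`.

What is NOT here: the printed statements allow structure functions WITH real zeros; for those
the reproducing property needs the removable-singularity bookkeeping for `F/E` on `ℝ` (not in
the tree). The reductions `deBranges1986_thm6_of_forall_hasReproducing`,
`deBranges1986_thm7_of_forall_hasReproducing` record exactly this remaining input. The real-zero
clauses of the strict remark ("no zero `w` with `w` or `w + i` real") are vacuous without real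
zeros and are de Branges' unproved assertion in general.

Vacuity note for `InClosedSpan` (statements file): `deBrangesNormSq` is a Bochner integral with
junk value `0` for non-integrable integrands; in Theorem 7 it is only applied to `F − L` with
`F` an element of the space and `L` a finite combination of generators `E(z)/(z − w)`, `w ∉ ℝ`,
for which `‖(F − L)/E‖²` IS integrable (`integrable_sq_sub_sum`), so no junk value arises.

## References

* L. de Branges, Bull. AMS 15 (1986) 1–17, pp. 3, 14–16 (read) [deBranges1986].
* J. B. Conrey, X.-J. Li, IMRN 2000:18 = arXiv:math/9812166, §2 (2.1)–(2.5) [ConreyLi2000].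
-/


noncomputable section

open scoped Real Topology ComplexConjugate
open _root_.Complex _root_.MeasureTheory _root_.Filter _root_.Set

namespace Literature.Analysis.DeBrangesSpaces

open DeBranges1986

variable {E : ℂ → ℂ}

/-! ### The reproducing identity as a property of `E` -/

/-- RH-FREE. **The reproducing property of `𝓗(E)`** as a predicate on the structure function:
`(F(t), K(w, t)) = F(w)` (de Branges 1986, p. 3 l. 22–25: "`K(w, z)` belongs to the space as a
function of `z` for every complex number `w` and `F(w) = (F(t), K(w, t))` for every element
`F(z)` of the space") for every non-real `w` and every entire `F` with `F/E ∈ L²(ℝ)` and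
`F/E, F♯/E = O(1/√(Im z))` far out in the upper half-plane (the class of Conrey–Li (2.2); every
element of the space is in it, `Mem.exists_joint_bound`). The tree proves it for `E` without
real zeros (`hasReproducing_of_noRealZeros`, from `deBrangesInner_deBrangesKernel`); the proofs
below take it as their only input about `E` beyond the printed hypotheses, so that they apply
verbatim once the property is established for structure functions with real zeros.
[cite: deBranges1986, p. 3] -/
def HasReproducing (E : ℂ → ℂ) : Prop :=
  ∀ F : ℂ → ℂ, Differentiable ℂ F → Integrable (fun x : ℝ => ‖F x / E x‖ ^ 2) →
    (∃ C R₀ : ℝ, ∀ z : ℂ, 0 < z.im → R₀ ≤ ‖z‖ →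
      ‖F z / E z‖ ≤ C / √z.im ∧ ‖sharp F z / E z‖ ≤ C / √z.im) →
    ∀ w : ℂ, w.im ≠ 0 → deBrangesInner E F (deBrangesKernel E w) = F w

/-- For a structure function without real zeros the reproducing property is the tree's
`deBrangesInner_deBrangesKernel` (Conrey–Li (2.2)). [cite: ConreyLi2000, §2 (2.2)] -/
theorem hasReproducing_of_noRealZeros (hE : IsHermiteBiehler E) (hreal : ∀ x : ℝ, E x ≠ 0) :
    HasReproducing E :=
  fun _ hF hF2 hFb _ hw => deBrangesInner_deBrangesKernel hE hreal hF hF2 hFb hw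

/-! ### Bookkeeping without the hypothesis "no real zeros" -/

/-- For entire `E`, `F`, the function `x ↦ F(x)/E(x)` is measurable on `ℝ` (no hypothesis on
the zeros of `E`; Lean's `a / 0 = 0`). [cite: deBranges1986, p. 3] -/
theorem aestronglyMeasurable_div_of_differentiable (hE : Differentiable ℂ E) {F : ℂ → ℂ}
    (hF : Differentiable ℂ F) : AEStronglyMeasurable (fun x : ℝ => F x / E x) volume :=
  ((hF.continuous.measurable.comp Complex.measurable_ofReal).div
    (hE.continuous.measurable.comp Complex.measurable_ofReal)).aestronglyMeasurable

/-- The integrand of `(F, G)_{𝓗(E)}` is `(F/E) · conj (G/E)` pointwise on `ℝ`, including at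
real zeros of `E` (both sides are then `0`). [cite: deBranges1986, p. 3] -/
theorem inner_integrand_eq' (E F G : ℂ → ℂ) (x : ℝ) :
    F x * conj (G x) / ((‖E x‖ : ℂ) ^ 2) = (F x / E x) * conj (G x / E x) := by
  by_cases hEx : E x = 0
  · simp [hEx]
  · have hEx' : conj (E x) ≠ 0 := (map_ne_zero _).2 hEx
    rw [← Complex.mul_conj' (E x), map_div₀]
    field_simp

/-- The integrand of `(F, G)_{𝓗(E)}` is integrable when `F/E, G/E ∈ L²(ℝ)`.
[cite: deBranges1986, p. 3] -/
theorem integrable_inner_integrand' {F G : ℂ → ℂ}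
    (hFm : AEStronglyMeasurable (fun x : ℝ => F x / E x) volume)
    (hGm : AEStronglyMeasurable (fun x : ℝ => G x / E x) volume)
    (hF2 : Integrable fun x : ℝ => ‖F x / E x‖ ^ 2)
    (hG2 : Integrable fun x : ℝ => ‖G x / E x‖ ^ 2) :
    Integrable fun x : ℝ => F x * conj (G x) / ((‖E x‖ : ℂ) ^ 2) := by
  simp_rw [inner_integrand_eq' E]
  refine Integrable.mono' ((hF2.add hG2).div_const 2) (hFm.mul hGm.star)
    (ae_of_all _ fun x => ?_)
  simp only [Pi.add_apply]
  rw [norm_mul, Complex.norm_conj]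
  nlinarith [sq_nonneg (‖F x / E x‖ - ‖G x / E x‖), norm_nonneg (F x / E x),
    norm_nonneg (G x / E x)]

/-- **Cauchy–Schwarz in `L²(ℝ, |E|⁻² dx)`**: `|(F, G)|² ≤ ‖F‖² ‖G‖²` (no hypothesis on the zeros
of `E`). [cite: deBranges1986, p. 3] -/
theorem norm_deBrangesInner_sq_le' {F G : ℂ → ℂ}
    (hFm : AEStronglyMeasurable (fun x : ℝ => F x / E x) volume)
    (hGm : AEStronglyMeasurable (fun x : ℝ => G x / E x) volume)
    (hF2 : Integrable fun x : ℝ => ‖F x / E x‖ ^ 2)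
    (hG2 : Integrable fun x : ℝ => ‖G x / E x‖ ^ 2) :
    ‖deBrangesInner E F G‖ ^ 2 ≤ deBrangesNormSq E F * deBrangesNormSq E G := by
  have hu : MemLp (fun x : ℝ => F x / E x) 2 volume :=
    (memLp_two_iff_integrable_sq_norm hFm).2 hF2
  have hv : MemLp (fun x : ℝ => G x / E x) 2 volume :=
    (memLp_two_iff_integrable_sq_norm hGm).2 hG2
  have h1 : ‖deBrangesInner E F G‖ ≤ ∫ x : ℝ, ‖F x / E x‖ * ‖G x / E x‖ := by
    unfold deBrangesInner
    simp_rw [inner_integrand_eq' E]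
    refine (MeasureTheory.norm_integral_le_integral_norm _).trans (le_of_eq ?_)
    refine integral_congr_ae (ae_of_all _ fun x => ?_)
    simp only [norm_mul, Complex.norm_conj]
  have h2 := integral_mul_norm_le_Lp_mul_Lq (μ := volume) Real.HolderConjugate.two_two
    (f := fun x : ℝ => F x / E x) (g := fun x : ℝ => G x / E x) (by simpa using hu)
    (by simpa using hv)
  simp only [Real.rpow_two, one_div] at h2
  have h3 : ‖deBrangesInner E F G‖ ≤
      (deBrangesNormSq E F) ^ (2⁻¹ : ℝ) * (deBrangesNormSq E G) ^ (2⁻¹ : ℝ) := h1.trans h2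
  have hA : 0 ≤ deBrangesNormSq E F := deBrangesNormSq_nonneg E F
  have hB : 0 ≤ deBrangesNormSq E G := deBrangesNormSq_nonneg E G
  calc ‖deBrangesInner E F G‖ ^ 2
      ≤ ((deBrangesNormSq E F) ^ (2⁻¹ : ℝ) * (deBrangesNormSq E G) ^ (2⁻¹ : ℝ)) ^ 2 :=
        pow_le_pow_left₀ (norm_nonneg _) h3 2
    _ = deBrangesNormSq E F * deBrangesNormSq E G := by
        rw [mul_pow, ← Real.rpow_natCast, ← Real.rpow_natCast, ← Real.rpow_mul hA,
          ← Real.rpow_mul hB]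
        norm_num

/-- `(F, G) ≤ ‖F‖ ‖G‖` in the form `Re (F, G) ≤ √(‖F‖² ‖G‖²)`. [cite: deBranges1986, p. 3] -/
theorem re_deBrangesInner_le_sqrt {F G : ℂ → ℂ}
    (hFm : AEStronglyMeasurable (fun x : ℝ => F x / E x) volume)
    (hGm : AEStronglyMeasurable (fun x : ℝ => G x / E x) volume)
    (hF2 : Integrable fun x : ℝ => ‖F x / E x‖ ^ 2)
    (hG2 : Integrable fun x : ℝ => ‖G x / E x‖ ^ 2) :
    (deBrangesInner E F G).re ≤ √(deBrangesNormSq E F * deBrangesNormSq E G) := by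
  refine (Complex.re_le_norm _).trans ?_
  rw [← Real.sqrt_sq (norm_nonneg (deBrangesInner E F G))]
  exact Real.sqrt_le_sqrt (norm_deBrangesInner_sq_le' hFm hGm hF2 hG2)

/-! ### The kernel functions, without the hypothesis "no real zeros" -/

/-- `‖K(w, z)/E(z)‖ ≤ (‖E w‖ + ‖E♯ w‖)/(2π)/‖z − w̄‖` at every point of the closed upper
half-plane where `E(z) ≠ 0`. [cite: ConreyLi2000, §2] -/
theorem norm_deBrangesKernel_div_le' (hE : IsHermiteBiehler E) (w : ℂ) {z : ℂ} (hz : 0 ≤ z.im)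
    (hEz : E z ≠ 0) :
    ‖deBrangesKernel E w z / E z‖ ≤ (‖E w‖ + ‖sharp E w‖) / (2 * π) / ‖z - conj w‖ := by
  by_cases hzw : z = conj w
  · subst hzw
    simp [deBrangesKernel]
  have hEz' : 0 < ‖E z‖ := norm_pos_iff.2 hEz
  have hzw' : 0 < ‖z - conj w‖ := norm_pos_iff.2 (sub_ne_zero.2 hzw)
  have hzw'' : ‖conj w - z‖ = ‖z - conj w‖ := norm_sub_rev _ _
  rw [norm_div, div_le_iff₀ hEz']
  refine (norm_deBrangesKernel_le E w z).trans ?_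
  rw [hzw'', div_le_iff₀ (by positivity)]
  have hs : ‖sharp E z‖ ≤ ‖E z‖ := hE.norm_sharp_le hz
  have : (‖E w‖ + ‖sharp E w‖) / (2 * π) / ‖z - conj w‖ * ‖E z‖ * (2 * π * ‖z - conj w‖) =
      ‖E z‖ * ‖E w‖ + ‖E z‖ * ‖sharp E w‖ := by
    field_simp
  rw [this]
  nlinarith [norm_nonneg (sharp E w)]

/-- **`K(w, ·)/E ∈ L²(ℝ)`** for non-real `w`, for every structure function `E` (at a real zero
of `E` the quotient is Lean's `0`). [cite: ConreyLi2000, §2] -/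
theorem integrable_sq_norm_deBrangesKernel_div' (hE : IsHermiteBiehler E) {w : ℂ}
    (hw : w.im ≠ 0) : Integrable fun x : ℝ => ‖deBrangesKernel E w x / E x‖ ^ 2 := by
  set M : ℝ := (‖E w‖ + ‖sharp E w‖) / (2 * π) with hM
  have hM0 : 0 ≤ M := by positivity
  have hcw : (conj w).im ≠ 0 := by simpa using hw
  refine Integrable.mono' ((integrable_norm_inv_ofReal_sub_sq hcw).const_mul (M ^ 2)) ?_
    (ae_of_all _ fun x => ?_)
  · refine (AEStronglyMeasurable.norm ?_).pow 2
    exact ((continuous_deBrangesKernel_ofReal hE.differentiable hw).measurable.div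
      (hE.differentiable.continuous.measurable.comp Complex.measurable_ofReal)).aestronglyMeasurable
  · rw [Real.norm_of_nonneg (by positivity), ← mul_pow]
    refine pow_le_pow_left₀ (norm_nonneg _) ?_ 2
    rw [norm_inv, ← div_eq_mul_inv]
    by_cases hEx : E x = 0
    · rw [hEx, div_zero, norm_zero]
      positivity
    · exact norm_deBrangesKernel_div_le' hE w (by simp) hEx

/-- **Decay of `K(w, ·)/E`** in the open upper half-plane: `‖K(w, z)/E(z)‖ ≤ C/√(Im z)` for
`Im z > 0`, `‖z‖` large (every structure function `E`). [cite: ConreyLi2000, §2] -/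
theorem exists_bound_deBrangesKernel_div' (hE : IsHermiteBiehler E) (w : ℂ) :
    ∃ C R₀ : ℝ, ∀ z : ℂ, 0 < z.im → R₀ ≤ ‖z‖ →
      ‖deBrangesKernel E w z / E z‖ ≤ C / √z.im := by
  set M : ℝ := (‖E w‖ + ‖sharp E w‖) / (2 * π) with hM
  have hM0 : 0 ≤ M := by positivity
  refine ⟨2 * M, max 1 (2 * ‖w‖), fun z hz hR => ?_⟩
  have h1 : 1 ≤ ‖z‖ := (le_max_left _ _).trans hR
  have h2 : 2 * ‖w‖ ≤ ‖z‖ := (le_max_right _ _).trans hR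
  have hzpos : 0 < ‖z‖ := by linarith
  have hzcw : ‖z‖ / 2 ≤ ‖z - conj w‖ := by
    have := norm_sub_norm_le z (conj w)
    rw [Complex.norm_conj] at this
    linarith
  have hsq : √z.im ≤ ‖z‖ := sqrt_im_le_norm h1
  have hypos : 0 < √z.im := Real.sqrt_pos.2 hz
  calc ‖deBrangesKernel E w z / E z‖ ≤ M / ‖z - conj w‖ :=
        norm_deBrangesKernel_div_le' hE w hz.le (hE.ne_zero_of_im_pos hz)
    _ ≤ M / (‖z‖ / 2) := div_le_div_of_nonneg_left hM0 (by positivity) hzcw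
    _ = 2 * M / ‖z‖ := by field_simp
    _ ≤ 2 * M / √z.im := div_le_div_of_nonneg_left (by positivity) hypos hsq

/-- The kernel functions satisfy the joint decay hypothesis (every structure function `E`): for
an entire `K` agreeing with `K(w, ·)` off `w̄` (`w` non-real), `K/E` and `K♯/E = K(w̄, ·)/E` are
`O(1/√(Im z))` far out. [cite: ConreyLi2000, §2] -/
theorem exists_joint_bound_kernel' (hE : IsHermiteBiehler E) {w : ℂ} (hw : w.im ≠ 0)
    {K : ℂ → ℂ} (hK : ∀ z : ℂ, z ≠ conj w → K z = deBrangesKernel E w z) :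
    ∃ C R₀ : ℝ, ∀ z : ℂ, 0 < z.im → R₀ ≤ ‖z‖ →
      ‖K z / E z‖ ≤ C / √z.im ∧ ‖sharp K z / E z‖ ≤ C / √z.im := by
  have hw0 : 0 < ‖w‖ := norm_pos_iff.2 (by rintro rfl; simp at hw)
  refine exists_joint_bound ?_ ?_
  · obtain ⟨C, R₀, h⟩ := exists_bound_deBrangesKernel_div' hE w
    refine ⟨C, max R₀ (2 * ‖w‖), fun z hz hR => ?_⟩
    have hz' : z ≠ conj w := by
      rintro rfl
      rw [Complex.norm_conj] at hR
      linarith [(le_max_right _ _).trans hR]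
    rw [hK z hz']
    exact h z hz ((le_max_left _ _).trans hR)
  · obtain ⟨C, R₀, h⟩ := exists_bound_deBrangesKernel_div' hE (conj w)
    refine ⟨C, max R₀ (2 * ‖w‖), fun z hz hR => ?_⟩
    have hz' : z ≠ w := by
      rintro rfl
      linarith [(le_max_right _ _).trans hR]
    have hsharp : sharp K z = deBrangesKernel E (conj w) z := by
      rw [← sharp_deBrangesKernel, sharp_apply, sharp_apply, hK (conj z)]
      intro h'
      exact hz' (by simpa using congrArg conj h')
    rw [hsharp]
    exact h z hz ((le_max_left _ _).trans hR)

/-! ### Members: decay, Cauchy–Schwarz kernel bound, linear combinations -/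

/-- **The kernel bound gives decay**: `|F(z)|² ≤ ‖F‖² K(z, z) ≤ ‖F‖² |E(z)|²/(4π Im z)` on the
upper half-plane, so `F/E` and (by `K(z̄, z̄) = K(z, z)`) `F♯/E` are `O(1/√(Im z))` there.
Consequently every element of the space is in the class of the reproducing identity.
[cite: deBranges1986, p. 3] -/
theorem HasKernelBound.exists_joint_bound (hE : IsHermiteBiehler E) {F : ℂ → ℂ}
    (hb : HasKernelBound E F) :
    ∃ C R₀ : ℝ, ∀ z : ℂ, 0 < z.im → R₀ ≤ ‖z‖ →
      ‖F z / E z‖ ≤ C / √z.im ∧ ‖sharp F z / E z‖ ≤ C / √z.im := by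
  set N : ℝ := deBrangesNormSq E F with hN
  have hN0 : 0 ≤ N := deBrangesNormSq_nonneg E F
  refine ⟨√(N / (4 * π)), 0, fun z hz _ => ?_⟩
  have hEz : 0 < ‖E z‖ := norm_pos_iff.2 (hE.ne_zero_of_im_pos hz)
  have hdiag : deBrangesKernelDiag E z ≤ ‖E z‖ ^ 2 / (4 * π * z.im) := by
    unfold deBrangesKernelDiag
    gcongr
    nlinarith [norm_nonneg (E (conj z))]
  have hkey : ∀ G : ℂ → ℂ, ‖G z‖ ^ 2 ≤ N * deBrangesKernelDiag E z →
      ‖G z / E z‖ ≤ √(N / (4 * π)) / √z.im := by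
    intro G hG
    have h1 : ‖G z‖ ^ 2 ≤ N * (‖E z‖ ^ 2 / (4 * π * z.im)) :=
      hG.trans (mul_le_mul_of_nonneg_left hdiag hN0)
    have h2 : ‖G z / E z‖ ^ 2 ≤ N / (4 * π) / z.im := by
      rw [norm_div, div_pow, div_le_iff₀ (by positivity)]
      calc ‖G z‖ ^ 2 ≤ N * (‖E z‖ ^ 2 / (4 * π * z.im)) := h1
        _ = N / (4 * π) / z.im * ‖E z‖ ^ 2 := by
            field_simp
    calc ‖G z / E z‖ = √(‖G z / E z‖ ^ 2) := (Real.sqrt_sq (norm_nonneg _)).symm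
      _ ≤ √(N / (4 * π) / z.im) := Real.sqrt_le_sqrt h2
      _ = √(N / (4 * π)) / √z.im := Real.sqrt_div' _ hz.le
  refine ⟨hkey F (hb z hz.ne'), ?_⟩
  have hcz : (conj z).im ≠ 0 := by simpa using hz.ne'
  have h := hb (conj z) hcz
  rw [deBrangesKernelDiag_conj] at h
  have h' : ‖sharp F z‖ ^ 2 ≤ N * deBrangesKernelDiag E z := by rwa [norm_sharp]
  exact hkey (sharp F) h'

/-- Every element of the space is in the class of the reproducing identity.
[cite: deBranges1986, p. 3] -/
theorem DeBranges1986.Mem.exists_joint_bound (hE : IsHermiteBiehler E) {F : ℂ → ℂ}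
    (h : Mem E F) :
    ∃ C R₀ : ℝ, ∀ z : ℂ, 0 < z.im → R₀ ≤ ‖z‖ →
      ‖F z / E z‖ ≤ C / √z.im ∧ ‖sharp F z / E z‖ ≤ C / √z.im :=
  h.hasKernelBound.exists_joint_bound hE

/-- The reproducing identity for elements of the space: `(F, K(w, ·)) = F(w)` for non-real `w`.
[cite: deBranges1986, p. 3] -/
theorem DeBranges1986.Mem.inner_kernel (hE : IsHermiteBiehler E) (hK : HasReproducing E)
    {F : ℂ → ℂ} (h : Mem E F) {w : ℂ} (hw : w.im ≠ 0) :
    deBrangesInner E F (deBrangesKernel E w) = F w :=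
  hK F h.differentiable h.integrable_sq (h.exists_joint_bound hE) w hw

/-- `‖K(w, ·)‖² = K(w, w)` for non-real `w` (the reproducing identity applied to the kernel
function itself). [cite: deBranges1986, p. 3] -/
theorem deBrangesNormSq_deBrangesKernel' (hE : IsHermiteBiehler E) (hK : HasReproducing E)
    {w : ℂ} (hw : w.im ≠ 0) :
    deBrangesNormSq E (deBrangesKernel E w) = deBrangesKernelDiag E w := by
  obtain ⟨K, hKd, hKeq, -⟩ := exists_differentiable_eq_deBrangesKernel hE.differentiable w
  have hKx : ∀ x : ℝ, K x = deBrangesKernel E w x := fun x => hKeq x (by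
    intro h
    have := congrArg Complex.im h
    simp only [ofReal_im, Complex.conj_im] at this
    exact hw (by linarith))
  have hK2 : Integrable fun x : ℝ => ‖K x / E x‖ ^ 2 := by
    simp_rw [hKx]
    exact integrable_sq_norm_deBrangesKernel_div' hE hw
  have hrep := hK K hKd hK2 (exists_joint_bound_kernel' hE hw hKeq) w hw
  have hww : w ≠ conj w := fun h => hw (Complex.conj_eq_iff_im.1 h.symm)
  rw [hKeq w hww, deBrangesKernel_self, ← deBrangesInner_congr_right hKx,
    deBrangesInner_self, deBrangesNormSq_congr hKx] at hrep
  exact_mod_cast hrep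

/-- **The kernel bound from the reproducing identity**: an entire `F` with `F/E ∈ L²(ℝ)` and
the joint decay satisfies `|F(z)|² ≤ ‖F‖² K(z, z)` off the real axis, i.e. is an element of the
space. [cite: deBranges1986, p. 3] -/
theorem DeBranges1986.Mem.of_bound (hE : IsHermiteBiehler E) (hK : HasReproducing E)
    {F : ℂ → ℂ} (hF : Differentiable ℂ F) (hF2 : Integrable fun x : ℝ => ‖F x / E x‖ ^ 2)
    (hFb : ∃ C R₀ : ℝ, ∀ z : ℂ, 0 < z.im → R₀ ≤ ‖z‖ →
      ‖F z / E z‖ ≤ C / √z.im ∧ ‖sharp F z / E z‖ ≤ C / √z.im) :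
    Mem E F := by
  refine ⟨hF, hF2, fun z hz => ?_⟩
  have hrep := hK F hF hF2 hFb z hz
  have hFm := aestronglyMeasurable_div_of_differentiable hE.differentiable hF
  have hKm : AEStronglyMeasurable (fun x : ℝ => deBrangesKernel E z x / E x) volume :=
    ((continuous_deBrangesKernel_ofReal hE.differentiable hz).measurable.div
      (hE.differentiable.continuous.measurable.comp Complex.measurable_ofReal)).aestronglyMeasurable
  have hCS := norm_deBrangesInner_sq_le' hFm hKm hF2
    (integrable_sq_norm_deBrangesKernel_div' hE hz)
  rwa [hrep, deBrangesNormSq_deBrangesKernel' hE hK hz] at hCS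

/-- The space is closed under `F ↦ F + μ G`. [cite: deBranges1986, p. 3] -/
theorem DeBranges1986.Mem.add_mul (hE : IsHermiteBiehler E) (hK : HasReproducing E)
    {F G : ℂ → ℂ} (hF : Mem E F) (hG : Mem E G) (μ : ℂ) :
    Mem E (fun z => F z + μ * G z) := by
  have hd := hE.differentiable
  refine Mem.of_bound hE hK (hF.differentiable.add (hG.differentiable.const_mul μ)) ?_ ?_
  · exact integrable_sq_add_mul μ (aestronglyMeasurable_div_of_differentiable hd hF.differentiable)
      (aestronglyMeasurable_div_of_differentiable hd hG.differentiable) hF.integrable_sq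
      hG.integrable_sq
  · exact exists_joint_bound_add_mul μ (hF.exists_joint_bound hE) (hG.exists_joint_bound hE)

/-- The space is closed under scalar multiplication (no reproducing property needed: both sides
of the kernel bound scale by `|μ|²`). [cite: deBranges1986, p. 3] -/
theorem DeBranges1986.Mem.const_mul {F : ℂ → ℂ} (hF : Mem E F) (μ : ℂ) :
    Mem E (fun z => μ * F z) := by
  refine ⟨hF.differentiable.const_mul μ, ?_, fun z hz => ?_⟩
  · have := hF.integrable_sq.const_mul (‖μ‖ ^ 2)
    refine this.congr (ae_of_all _ fun x => ?_)
    simp only [mul_div_assoc, norm_mul, mul_pow]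
  · have hnorm : deBrangesNormSq E (fun z => μ * F z) = ‖μ‖ ^ 2 * deBrangesNormSq E F := by
      unfold deBrangesNormSq
      rw [← MeasureTheory.integral_const_mul]
      refine integral_congr_ae (ae_of_all _ fun x => ?_)
      simp only [mul_div_assoc, norm_mul, mul_pow]
    rw [hnorm]
    calc ‖μ * F z‖ ^ 2 = ‖μ‖ ^ 2 * ‖F z‖ ^ 2 := by rw [norm_mul, mul_pow]
      _ ≤ ‖μ‖ ^ 2 * (deBrangesNormSq E F * deBrangesKernelDiag E z) :=
          mul_le_mul_of_nonneg_left (hF.hasKernelBound z hz) (sq_nonneg _)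
      _ = ‖μ‖ ^ 2 * deBrangesNormSq E F * deBrangesKernelDiag E z := by ring

/-- Membership only depends on the function (transport along an equality of functions given
pointwise). [cite: deBranges1986, p. 3] -/
theorem DeBranges1986.Mem.congr {F G : ℂ → ℂ} (hF : Mem E F) (h : ∀ z, F z = G z) : Mem E G := by
  have : F = G := funext h
  rwa [← this]

/-- The shift domain is closed under `F ↦ F + μ G`. [cite: deBranges1986, Theorem 6] -/
theorem DeBranges1986.ShiftMem.add_mul (hE : IsHermiteBiehler E) (hK : HasReproducing E)
    {F G : ℂ → ℂ} (hF : ShiftMem E F) (hG : ShiftMem E G) (μ : ℂ) :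
    ShiftMem E (fun z => F z + μ * G z) :=
  ⟨hF.1.add_mul hE hK hG.1 μ, hF.2.add_mul hE hK hG.2 μ⟩

/-- An element of the space with `‖F‖ = 0` vanishes identically (kernel bound off the real axis,
continuity on it). [cite: deBranges1986, p. 3] -/
theorem DeBranges1986.Mem.eq_zero_of_normSq_eq_zero {F : ℂ → ℂ} (hF : Mem E F)
    (h0 : deBrangesNormSq E F = 0) : F = 0 := by
  have hoff : ∀ z : ℂ, z.im ≠ 0 → F z = 0 := by
    intro z hz
    have := hF.hasKernelBound z hz
    rw [h0, zero_mul] at this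
    exact norm_eq_zero.1 (pow_eq_zero_iff two_ne_zero |>.1 (le_antisymm this (sq_nonneg _)))
  funext z
  by_cases hz : z.im ≠ 0
  · exact hoff z hz
  · push Not at hz
    -- `z` real: `F z = lim_{y → 0⁺} F (z + iy)`
    have hcont : ContinuousAt F z := (hF.differentiable z).continuousAt
    have hpath : Tendsto (fun y : ℝ => z + y * I) (𝓝[>] 0) (𝓝 z) := by
      have hc : Continuous (fun y : ℝ => z + y * I) := by fun_prop
      have := hc.tendsto 0
      simp only [Complex.ofReal_zero, zero_mul, add_zero] at this
      exact this.mono_left nhdsWithin_le_nhds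
    have h1 : Tendsto (fun y : ℝ => F (z + y * I)) (𝓝[>] 0) (𝓝 (F z)) :=
      hcont.tendsto.comp hpath
    have h2 : Tendsto (fun y : ℝ => F (z + y * I)) (𝓝[>] 0) (𝓝 0) := by
      refine tendsto_const_nhds.congr' ?_
      filter_upwards [self_mem_nhdsWithin] with y hy
      rw [hoff]
      have : (z + (y : ℂ) * I).im = y := by simp [hz]
      rw [this]
      exact (ne_of_lt hy).symm
    exact tendsto_nhds_unique h1 h2


/-! ### Linear dependence of `E(· − i)` and `E♯` -/

/-- For `E ≢ 0`, "`E(z − i)` and `E♯(z)` are linearly dependent" is Conrey–Li's functional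
identity `E♯(z) = ε E(z − i)` with `|ε| = 1` (`ε ≠ 0` by dependence; `|ε| = 1` by applying `♯`
twice). [cite: deBranges1986, Theorem 6] -/
theorem DeBranges1986.ShiftLinDep.exists_eps (h : ShiftLinDep E) {z₀ : ℂ} (hz₀ : E z₀ ≠ 0) :
    ∃ ε : ℂ, ‖ε‖ = 1 ∧ ∀ z : ℂ, sharp E z = ε * E (z - I) := by
  obtain ⟨a, b, hab, hid⟩ := shiftLinDep_iff.1 h
  have hb : b ≠ 0 := by
    intro hb
    have ha : a ≠ 0 := fun ha => hab ⟨ha, hb⟩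
    have := hid (z₀ + I)
    rw [hb, zero_mul, add_zero, add_sub_cancel_right] at this
    exact hz₀ ((mul_eq_zero.1 this).resolve_left ha)
  set ε : ℂ := -a / b with hε
  have hfe : ∀ z, sharp E z = ε * E (z - I) := by
    intro z
    have := hid z
    rw [hε]
    field_simp
    linear_combination this
  have h3 : E (conj z₀ - I) = conj ε * conj (E z₀) := by
    have e1 : conj z₀ - I = conj (z₀ + I) := by
      rw [map_add, Complex.conj_I, sub_eq_add_neg]
    have e2 : E (conj (z₀ + I)) = conj (sharp E (z₀ + I)) := by
      rw [sharp_apply, Complex.conj_conj]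
    rw [e1, e2, hfe, add_sub_cancel_right, map_mul]
  have key : conj (E z₀) = ε * conj ε * conj (E z₀) := by
    calc conj (E z₀) = sharp E (conj z₀) := by rw [sharp_apply, Complex.conj_conj]
      _ = ε * E (conj z₀ - I) := hfe _
      _ = ε * (conj ε * conj (E z₀)) := by rw [h3]
      _ = ε * conj ε * conj (E z₀) := by ring
  have hεε : ε * conj ε = 1 := by
    have hc : conj (E z₀) ≠ 0 := (map_ne_zero _).2 hz₀
    have h' : (ε * conj ε - 1) * conj (E z₀) = 0 := by linear_combination -key
    exact sub_eq_zero.1 ((mul_eq_zero.1 h').resolve_right hc)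
  refine ⟨ε, ?_, hfe⟩
  have hsq : ‖ε‖ ^ 2 = 1 := by
    have := congrArg (fun u : ℂ => u.re) hεε
    simp only [Complex.mul_conj', Complex.one_re] at this
    exact_mod_cast this
  have := Real.sqrt_sq (norm_nonneg ε)
  rw [hsq, Real.sqrt_one] at this
  exact this.symm

/-- A structure function is not identically zero (`E(i) ≠ 0`). [folklore] -/
private theorem IsHermiteBiehler.apply_I_ne_zero (hE : IsHermiteBiehler E) : E I ≠ 0 :=
  hE.ne_zero_of_im_pos (by simp)

/-! ### Zeros under the functional identity -/

/-- Under `E♯(z) = ε E(z − i)` the zeros of `E` come in pairs `w`, `w̄ − i`; since a structure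
function has no zeros in the open upper half-plane, a zero `w` with `w ∉ ℝ` and `w + i ∉ ℝ`
lies in the open strip `−1 < Im w < 0` (de Branges, p. 14 l. 23–25). [cite: deBranges1986,
p. 14] -/
theorem zero_mem_strip (hE : IsHermiteBiehler E) {ε : ℂ}
    (hfe : ∀ z : ℂ, sharp E z = ε * E (z - I)) {w : ℂ} (hw : E w = 0) (h0 : w.im ≠ 0)
    (h1 : (w + I).im ≠ 0) : w.im < 0 ∧ -1 < w.im := by
  constructor
  · rcases lt_or_gt_of_ne h0 with h | h
    · exact h
    · exact absurd hw (hE.ne_zero_of_im_pos h)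
  · have h2 : E (conj w - I) = 0 := by
      have h3 : sharp E (w + I) = 0 := by rw [hfe, add_sub_cancel_right, hw, mul_zero]
      rw [sharp_apply, map_eq_zero, map_add, Complex.conj_I, ← sub_eq_add_neg] at h3
      exact h3
    by_contra hle
    push Not at hle
    rcases hle.lt_or_eq with hlt | heq
    · refine hE.ne_zero_of_im_pos (z := conj w - I) ?_ h2
      simp only [sub_im, Complex.conj_im, Complex.I_im]
      linarith
    · apply h1
      simp [heq]

/-! ### The kernel functions as elements of the space -/

/-- **`K(w, ·)` is an element of the space** for non-real `w` (every structure function with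
the reproducing property): the entire extension of `z ↦ K(w, z)`, its value at `z = w̄`, its
agreement with `K(w, ·)` on `ℝ`, and its membership. [cite: deBranges1986, p. 3] -/
theorem exists_kernel_mem (hE : IsHermiteBiehler E) (hK : HasReproducing E) {w : ℂ}
    (hw : w.im ≠ 0) :
    ∃ K : ℂ → ℂ, Differentiable ℂ K ∧ (∀ z : ℂ, z ≠ conj w → K z = deBrangesKernel E w z) ∧
      K (conj w) = (conj (deriv E w) * E (conj w) - deriv E (conj w) * conj (E w)) /
        (2 * π * I) ∧ (∀ x : ℝ, K x = deBrangesKernel E w x) ∧ Mem E K := by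
  obtain ⟨K, hKd, hKeq, hKval⟩ := exists_differentiable_eq_deBrangesKernel hE.differentiable w
  have hKx : ∀ x : ℝ, K x = deBrangesKernel E w x := fun x => hKeq x (by
    intro h
    have := congrArg Complex.im h
    simp only [ofReal_im, Complex.conj_im] at this
    exact hw (by linarith))
  have hK2 : Integrable fun x : ℝ => ‖K x / E x‖ ^ 2 := by
    simp_rw [hKx]
    exact integrable_sq_norm_deBrangesKernel_div' hE hw
  exact ⟨K, hKd, hKeq, hKval, hKx,
    Mem.of_bound hE hK hKd hK2 (exists_joint_bound_kernel' hE hw hKeq)⟩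

/-- A nonzero-norm criterion: an element agreeing on `ℝ` with `K(w, ·)`, `w` non-real, is not
the zero function (`‖K(w, ·)‖² = K(w, w) > 0`). [cite: deBranges1986, p. 15] -/
theorem kernel_ne_zero (hE : IsHermiteBiehler E) (hK : HasReproducing E) {w : ℂ} (hw : w.im ≠ 0)
    {K : ℂ → ℂ} (hKx : ∀ x : ℝ, K x = deBrangesKernel E w x) : K ≠ 0 := by
  intro h0
  have h1 : deBrangesNormSq E K = deBrangesKernelDiag E w := by
    rw [deBrangesNormSq_congr hKx, deBrangesNormSq_deBrangesKernel' hE hK hw]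
  have h2 : deBrangesNormSq E K = 0 := by
    rw [h0]
    simp [deBrangesNormSq]
  have := hE.deBrangesKernelDiag_pos hw
  linarith

/-- **de Branges' element `K(w, ·)` of the shift domain at a zero `w`** (proof of Theorem 6,
p. 15 l. 2–18): for a zero `w` of `E` with `w, w + i ∉ ℝ`, the kernel function `K = K(w, ·)` is a
nonzero element of the space with `K(· + i)` in the space (the identity
`conj E(w + i) K(w, z + i) = −conj E(w − i) K(w + i, z)`), `(K(t + i), K(t)) = K(w, w + i)`, the
value `K(w, w̄) = conj E′(w) E(w̄)/(2πi)`, and for every `F` in the shift domain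
`(F(t + i), K(w, t)) + (F(t), K(w, t + i)) = ((E(w + i) − E(w − i))/E(w + i)) F(w + i)`.
[cite: deBranges1986, p. 15] -/
theorem exists_shiftMem_kernel (hE : IsHermiteBiehler E) (hK : HasReproducing E) {ε : ℂ}
    (hεn : ‖ε‖ = 1) (hfe : ∀ z : ℂ, sharp E z = ε * E (z - I)) {w₀ : ℂ} (hw₀ : E w₀ = 0)
    (h0 : w₀.im ≠ 0) (h1 : (w₀ + I).im ≠ 0) :
    ∃ K : ℂ → ℂ, ShiftMem E K ∧ K ≠ 0 ∧ (∀ x : ℝ, K x = deBrangesKernel E w₀ x) ∧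
      (∀ z : ℂ, z ≠ conj w₀ → K z = deBrangesKernel E w₀ z) ∧
      K (conj w₀) = conj (deriv E w₀) * E (conj w₀) / (2 * π * I) ∧
      deBrangesInner E (fun z => K (z + I)) K = K (w₀ + I) ∧
      ∀ F : ℂ → ℂ, ShiftMem E F →
        shiftForm E F K = (E (w₀ + I) - E (w₀ - I)) / E (w₀ + I) * F (w₀ + I) := by
  obtain ⟨hneg, hgt⟩ := zero_mem_strip hE hfe hw₀ h0 h1
  have hπ : (2 * π * I : ℂ) ≠ 0 := by simp [Real.pi_ne_zero]
  have hε0 : ε ≠ 0 := fun h => by simp [h] at hεn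
  have hεε : conj ε * ε = 1 := by
    rw [mul_comm, Complex.mul_conj', hεn]
    norm_num
  have hw₁im : (w₀ + I).im ≠ 0 := h1
  have hw₁pos : 0 < (w₀ + I).im := by
    simp only [add_im, Complex.I_im]
    linarith
  have hE1 : E (w₀ + I) ≠ 0 := hE.ne_zero_of_im_pos hw₁pos
  have hEs : sharp E w₀ ≠ 0 := by
    rw [sharp_apply, map_ne_zero]
    exact hE.ne_zero_of_im_pos (by simpa using hneg)
  have hE1' : conj (E (w₀ + I)) ≠ 0 := (map_ne_zero _).2 hE1
  have hEs' : conj (sharp E w₀) ≠ 0 := (map_ne_zero _).2 hEs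
  have hsE1 : sharp E (w₀ + I) = 0 := by rw [hfe, add_sub_cancel_right, hw₀, mul_zero]
  have hker : ∀ z : ℂ, deBrangesKernel E w₀ z =
      -(sharp E z * conj (sharp E w₀)) / (2 * π * I * (conj w₀ - z)) := by
    intro z
    simp only [deBrangesKernel, hw₀, map_zero, mul_zero, zero_sub]
  -- the two kernel elements
  obtain ⟨K, hKd, hKeq, hKval, hKx, hKmem⟩ := exists_kernel_mem hE hK h0
  obtain ⟨K₁, hK₁d, hK₁eq, -, hK₁x, hK₁mem⟩ := exists_kernel_mem hE hK hw₁im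
  -- the shift identity: `K(z + i) = c · K(w₀ + i, z)`
  set c : ℂ := -(ε * conj (sharp E w₀) / conj (E (w₀ + I))) with hc
  have hc0 : c ≠ 0 := by
    rw [hc, neg_ne_zero]
    exact div_ne_zero (mul_ne_zero hε0 hEs') hE1'
  have hshift : ∀ z : ℂ, z ≠ conj w₀ - I → K (z + I) = c * deBrangesKernel E (w₀ + I) z := by
    intro z hz
    have hz' : z + I ≠ conj w₀ := fun h => hz (by rw [← h]; ring)
    rw [hKeq _ hz', hker]
    simp only [deBrangesKernel, hsE1, map_zero, mul_zero, sub_zero, hc, map_add, Complex.conj_I]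
    rw [hfe (z + I), add_sub_cancel_right]
    have hden : conj w₀ - (z + I) ≠ 0 := sub_ne_zero.2 (Ne.symm hz')
    have hden' : conj w₀ + -I - z ≠ 0 := by
      convert hden using 1
      ring
    field_simp
    ring
  have hfun : (fun z => K (z + I)) = fun z => c * K₁ z := by
    have hc1 : Continuous fun z => K (z + I) := hKd.continuous.comp (continuous_add_const I)
    have hc2 : Continuous fun z => c * K₁ z := continuous_const.mul hK₁d.continuous
    refine Continuous.ext_on (dense_compl_singleton (conj w₀ - I)) hc1 hc2 fun z hz => ?_
    have hz : z ≠ conj w₀ - I := hz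
    have hz' : z ≠ conj (w₀ + I) := by
      rwa [map_add, Complex.conj_I, ← sub_eq_add_neg]
    show K (z + I) = c * K₁ z
    rw [hshift z hz, hK₁eq z hz']
  have hKsx : ∀ x : ℝ, K (x + I) = c * deBrangesKernel E (w₀ + I) x := fun x => by
    have h : K (x + I) = c * K₁ x := congrFun hfun x
    rw [h, hK₁x]
  have hKsmem : Mem E (fun z => K (z + I)) :=
    (hK₁mem.const_mul c).congr fun z => (congrFun hfun z).symm
  have hKD : ShiftMem E K := ⟨hKmem, hKsmem⟩
  -- `(K(t + i), K(t)) = K(w₀ + i)`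
  have hinner : deBrangesInner E (fun z => K (z + I)) K = K (w₀ + I) := by
    rw [deBrangesInner_congr_right (F := fun z => K (z + I)) (G := K)
      (G' := deBrangesKernel E w₀) hKx]
    exact hKsmem.inner_kernel hE hK h0
  -- `1 + conj c = (E(w₀ + i) − E(w₀ − i))/E(w₀ + i)`
  have hcc : 1 + conj c = (E (w₀ + I) - E (w₀ - I)) / E (w₀ + I) := by
    have e1 : conj c = -(E (w₀ - I) / E (w₀ + I)) := by
      rw [hc, map_neg, map_div₀, map_mul, Complex.conj_conj, Complex.conj_conj, hfe w₀,
        ← mul_assoc, hεε, one_mul]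
    rw [e1]
    field_simp
    ring
  refine ⟨K, hKD, kernel_ne_zero hE hK h0 hKx, hKx, hKeq, ?_, hinner, fun F hF => ?_⟩
  · rw [hKval, hw₀, map_zero, mul_zero, sub_zero]
  · -- the pairing identity
    have e1 : deBrangesInner E (fun z => F (z + I)) K = F (w₀ + I) := by
      rw [deBrangesInner_congr_right (F := fun z => F (z + I)) (G := K)
        (G' := deBrangesKernel E w₀) hKx]
      exact hF.2.inner_kernel hE hK h0
    have e2 : deBrangesInner E F (fun z => K (z + I)) = conj c * F (w₀ + I) := by
      rw [deBrangesInner_congr_right (F := F) (G := fun z => K (z + I))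
        (G' := fun z => c * deBrangesKernel E (w₀ + I) z) hKsx, deBrangesInner_const_mul_right,
        hF.1.inner_kernel hE hK hw₁im]
    rw [shiftForm, e1, e2, ← hcc]
    ring

/-! ### The Schwarz inequality for de Branges' scalar product -/

/-- **Schwarz-inequality step** (p. 16, l. 2–6; Conrey–Li (2.5)): if the positivity condition
holds on the shift domain and the form vanishes on an element `G` of the shift domain
(`Re (G(t + i), G(t)) = 0`), then `(F(t + i), G(t)) + (F(t), G(t + i)) = 0` for every `F` in the
shift domain (expand the condition for `F + μ G`). [cite: deBranges1986, p. 16] -/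
theorem shiftForm_eq_zero_of_re_eq_zero (hE : IsHermiteBiehler E) (hK : HasReproducing E)
    (hpos : ShiftNonneg E) {F G : ℂ → ℂ} (hF : ShiftMem E F) (hG : ShiftMem E G)
    (hG0 : (deBrangesInner E (fun z => G (z + I)) G).re = 0) : shiftForm E F G = 0 := by
  have hd := hE.differentiable
  -- measurability and square integrability of the four quotients
  have mA : AEStronglyMeasurable (fun x : ℝ => F (x + I) / E x) volume :=
    aestronglyMeasurable_div_of_differentiable hd hF.2.differentiable
  have mB : AEStronglyMeasurable (fun x : ℝ => G (x + I) / E x) volume :=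
    aestronglyMeasurable_div_of_differentiable hd hG.2.differentiable
  have mA' : AEStronglyMeasurable (fun x : ℝ => F x / E x) volume :=
    aestronglyMeasurable_div_of_differentiable hd hF.1.differentiable
  have mB' : AEStronglyMeasurable (fun x : ℝ => G x / E x) volume :=
    aestronglyMeasurable_div_of_differentiable hd hG.1.differentiable
  have iA : Integrable fun x : ℝ => ‖F (x + I) / E x‖ ^ 2 := hF.2.integrable_sq
  have iB : Integrable fun x : ℝ => ‖G (x + I) / E x‖ ^ 2 := hG.2.integrable_sq
  have iA' : Integrable fun x : ℝ => ‖F x / E x‖ ^ 2 := hF.1.integrable_sq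
  have iB' : Integrable fun x : ℝ => ‖G x / E x‖ ^ 2 := hG.1.integrable_sq
  have h1 := integrable_inner_integrand' (E := E) (F := fun u => F (u + I)) (G := F) mA mA' iA iA'
  have h2 := integrable_inner_integrand' (E := E) (F := fun u => F (u + I)) (G := G) mA mB' iA iB'
  have h3 := integrable_inner_integrand' (E := E) (F := fun u => G (u + I)) (G := F) mB mA' iB iA'
  have h4 := integrable_inner_integrand' (E := E) (F := fun u => G (u + I)) (G := G) mB mB' iB iB'
  -- positivity for `F + μ G`
  have hineq : ∀ μ : ℂ, 0 ≤ (deBrangesInner E (fun z => F (z + I) + μ * G (z + I))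
      (fun z => F z + μ * G z)).re :=
    fun μ => hpos (fun z => F z + μ * G z) (hF.add_mul hE hK hG μ)
  set S : ℂ := shiftForm E F G with hSdef
  set a : ℝ := (deBrangesInner E (fun z => F (z + I)) F).re with ha
  by_contra hS
  have hS2 : 0 < ‖S‖ ^ 2 := pow_pos (norm_pos_iff.2 hS) 2
  set t : ℝ := (a + 1) / ‖S‖ ^ 2 with ht
  have htS : t * ‖S‖ ^ 2 = a + 1 := by rw [ht, div_mul_cancel₀ _ hS2.ne']
  have key := hineq (-(t : ℂ) * S)
  rw [deBrangesInner_add_mul_expand (A := fun z => F (z + I)) (B := fun z => G (z + I))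
    (A' := F) (B' := G) _ h1 h2 h3 h4] at key
  -- real parts: the cross terms combine to `Re (conj μ · S)`, the last term has real part 0
  have hBA : deBrangesInner E (fun z => G (z + I)) F =
      conj (deBrangesInner E F (fun z => G (z + I))) := deBrangesInner_conj_symm _ _
  have hre : (deBrangesInner E (fun z => F (z + I)) F +
      conj (-(t : ℂ) * S) * deBrangesInner E (fun z => F (z + I)) G +
      -(t : ℂ) * S * deBrangesInner E (fun z => G (z + I)) F +
      -(t : ℂ) * S * conj (-(t : ℂ) * S) * deBrangesInner E (fun z => G (z + I)) G).re
      = a - t * ‖S‖ ^ 2 := by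
    have e1 : (-(t : ℂ) * S * deBrangesInner E (fun z => G (z + I)) F).re =
        (conj (-(t : ℂ) * S) * deBrangesInner E F (fun z => G (z + I))).re := by
      rw [hBA, ← Complex.conj_re (-(t : ℂ) * S * conj _), map_mul, Complex.conj_conj]
    have e2 : conj (-(t : ℂ) * S) * deBrangesInner E (fun z => F (z + I)) G +
        conj (-(t : ℂ) * S) * deBrangesInner E F (fun z => G (z + I)) =
        (((-(t * ‖S‖ ^ 2) : ℝ)) : ℂ) := by
      rw [← mul_add, ← shiftForm_apply, ← hSdef, map_mul, map_neg, Complex.conj_ofReal,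
        show -(t : ℂ) * conj S * S = -((t : ℂ) * (conj S * S)) by ring, Complex.conj_mul' S]
      push_cast
      ring
    have e3 : (-(t : ℂ) * S * conj (-(t : ℂ) * S) * deBrangesInner E (fun z => G (z + I)) G).re
        = 0 := by
      rw [Complex.mul_conj', ← Complex.ofReal_pow, Complex.re_ofReal_mul, hG0, mul_zero]
    simp only [Complex.add_re]
    rw [e3, add_zero, e1, add_assoc, ← Complex.add_re, e2, Complex.ofReal_re, ← ha]
    ring
  rw [hre, htS] at key
  linarith

/-- The form is Hermitian: `[G, F] = conj [F, G]`. [cite: deBranges1986, p. 15] -/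
theorem shiftForm_conj_symm (F G : ℂ → ℂ) :
    shiftForm E G F = conj (shiftForm E F G) := by
  rw [shiftForm, shiftForm, map_add, ← deBrangesInner_conj_symm, ← deBrangesInner_conj_symm,
    add_comm]

/-- On the diagonal `Re [F, F] = 2 Re (F(t + i), F(t))`. [cite: deBranges1986, p. 15] -/
theorem shiftForm_self_re (F : ℂ → ℂ) :
    (shiftForm E F F).re = 2 * (deBrangesInner E (fun z => F (z + I)) F).re := by
  rw [shiftForm, deBrangesInner_conj_symm F (fun z => F (z + I)), Complex.add_re,
    Complex.conj_re]
  ring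

/-! ### Dividing out the zero: an element of the shift domain not vanishing at `w + i` -/

/-- **"Iteration produces an element `F(z)` of the space such that `F(z + i)` belongs to the
space but such that `F(w + i)` is nonzero"** (p. 16, l. 12–15; Conrey–Li: the member
`E♯(z)/(z − w − i)ⁿ`): at a zero `w` of `E` with `w, w + i ∉ ℝ` there is an element `G` of the
shift domain with `G(w + i) ≠ 0`. [cite: deBranges1986, p. 16] -/
theorem exists_shiftMem_apply_ne_zero (hE : IsHermiteBiehler E) (hK : HasReproducing E)
    {ε : ℂ} (hεn : ‖ε‖ = 1) (hfe : ∀ z : ℂ, sharp E z = ε * E (z - I)) {w₀ : ℂ}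
    (hw₀ : E w₀ = 0) (h0 : w₀.im ≠ 0) (h1 : (w₀ + I).im ≠ 0) :
    ∃ G : ℂ → ℂ, ShiftMem E G ∧ G (w₀ + I) ≠ 0 := by
  obtain ⟨hneg, hgt⟩ := zero_mem_strip hE hfe hw₀ h0 h1
  have hd := hE.differentiable
  have hw₁im : (w₀ + I).im ≠ 0 := h1
  have hEs : sharp E w₀ ≠ 0 := by
    rw [sharp_apply, map_ne_zero]
    exact hE.ne_zero_of_im_pos (by simpa using hneg)
  have hsE1 : sharp E (w₀ + I) = 0 := by rw [hfe, add_sub_cancel_right, hw₀, mul_zero]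
  obtain ⟨n, G, hn, hGd, hG0, hGeq⟩ :=
    exists_div_pow_of_zero (differentiable_sharp hd) (z₀ := w₀ + I) (z₁ := w₀) hsE1 hEs
  refine ⟨G, ?_, hG0⟩
  have hGm := aestronglyMeasurable_div_of_differentiable hd hGd
  have hGsd : Differentiable ℂ (fun z => G (z + I)) := fun z =>
    (hGd (z + I)).comp z (differentiableAt_id.add_const I)
  have hGsm := aestronglyMeasurable_div_of_differentiable hd hGsd
  -- values of `G`, `G♯`, `G(· + i)`, `G(· + i)♯` divided by `E`
  have hGv : ∀ z : ℂ, z ≠ w₀ + I → G z / E z = sharp E z / E z / (z - (w₀ + I)) ^ n := by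
    intro z hz
    rw [hGeq z hz, div_right_comm]
  have hGsv : ∀ z : ℂ, z ≠ conj w₀ - I → E z ≠ 0 →
      sharp G z / E z = 1 / (z - (conj w₀ - I)) ^ n := by
    intro z hz hEz
    have hz' : conj z ≠ w₀ + I := by
      intro h
      apply hz
      rw [← Complex.conj_conj z, h, map_add, Complex.conj_I, sub_eq_add_neg]
    rw [sharp_apply, hGeq _ hz', map_div₀, map_pow, map_sub, map_add, Complex.conj_I,
      Complex.conj_conj, ← sub_eq_add_neg, div_right_comm]
    have : conj (sharp E (conj z)) = E z := by simp [sharp_apply]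
    rw [this, div_self hEz]
  have hGshift : ∀ z : ℂ, z ≠ w₀ → G (z + I) = ε * E z / (z - w₀) ^ n := by
    intro z hz
    have hz' : z + I ≠ w₀ + I := fun h => hz (add_right_cancel h)
    rw [hGeq _ hz', hfe, add_sub_cancel_right, add_sub_add_right_eq_sub]
  have hGsv' : ∀ z : ℂ, z ≠ w₀ → E z ≠ 0 → G (z + I) / E z = ε / (z - w₀) ^ n := by
    intro z hz hEz
    rw [hGshift z hz, div_right_comm, mul_div_assoc, div_self hEz, mul_one]
  have hGssv : ∀ z : ℂ, z ≠ conj w₀ →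
      sharp (fun u => G (u + I)) z / E z = conj ε * (sharp E z / E z) / (z - conj w₀) ^ n := by
    intro z hz
    have hz' : conj z ≠ w₀ := fun h => hz (by rw [← Complex.conj_conj z, h])
    simp only [sharp_apply]
    rw [hGshift _ hz', map_div₀, map_mul, map_pow, map_sub, Complex.conj_conj]
    ring
  -- membership of `G`
  have hb1 : ∀ x : ℝ, ‖G x / E x‖ ≤ 1 / ‖(x : ℂ) - (w₀ + I)‖ ^ n := by
    intro x
    have hx : (x : ℂ) ≠ w₀ + I := by
      intro h
      have := congrArg Complex.im h
      simp only [ofReal_im, add_im, Complex.I_im] at this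
      linarith
    by_cases hEx : E x = 0
    · rw [hEx, div_zero, norm_zero]
      positivity
    · rw [hGv _ hx, norm_div, norm_div, norm_pow, sharp_ofReal, Complex.norm_conj,
        div_self (norm_ne_zero_iff.2 hEx)]
  have hG2 : Integrable fun x : ℝ => ‖G x / E x‖ ^ 2 :=
    integrable_sq_of_le_inv_pow hw₁im hn hGm hb1
  have hb1' : ∀ z : ℂ, 0 < z.im → ‖w₀ + I‖ + 1 ≤ ‖z‖ →
      ‖G z / E z‖ ≤ 1 / ‖z - (w₀ + I)‖ ^ n := by
    intro z hz hR
    have hz' : z ≠ w₀ + I := by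
      rintro rfl
      linarith
    have hEz : E z ≠ 0 := hE.ne_zero_of_im_pos hz
    rw [hGv _ hz', norm_div _ ((z - (w₀ + I)) ^ n), norm_pow]
    refine div_le_div_of_nonneg_right ?_ (by positivity)
    rw [norm_div, div_le_one (norm_pos_iff.2 hEz)]
    exact hE.norm_sharp_le hz.le
  have hb2' : ∀ z : ℂ, 0 < z.im → 0 ≤ ‖z‖ →
      ‖sharp G z / E z‖ ≤ 1 / ‖z - (conj w₀ - I)‖ ^ n := by
    intro z hz _
    have hz' : z ≠ conj w₀ - I := by
      intro h
      have := congrArg Complex.im h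
      simp only [sub_im, Complex.conj_im, Complex.I_im] at this
      linarith
    rw [hGsv _ hz' (hE.ne_zero_of_im_pos hz), norm_div, norm_one, norm_pow]
  have hGb := exists_joint_bound (E := E) (F := G) (exists_bound_of_le_inv_pow hn hb1')
    (exists_bound_of_le_inv_pow hn hb2')
  -- membership of `G(· + i)`
  have hb3 : ∀ x : ℝ, ‖G (x + I) / E x‖ ≤ 1 / ‖(x : ℂ) - w₀‖ ^ n := by
    intro x
    have hx : (x : ℂ) ≠ w₀ := by
      intro h
      have := congrArg Complex.im h
      simp only [ofReal_im] at this
      exact h0 this.symm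
    by_cases hEx : E x = 0
    · rw [hEx, div_zero, norm_zero]
      positivity
    · rw [hGsv' _ hx hEx, norm_div, hεn, norm_pow]
  have hGs2 : Integrable fun x : ℝ => ‖G (x + I) / E x‖ ^ 2 :=
    integrable_sq_of_le_inv_pow (H := fun u => G (u + I)) h0 hn hGsm hb3
  have hb3' : ∀ z : ℂ, 0 < z.im → 0 ≤ ‖z‖ → ‖G (z + I) / E z‖ ≤ 1 / ‖z - w₀‖ ^ n := by
    intro z hz _
    have hz' : z ≠ w₀ := by
      rintro rfl
      linarith
    rw [hGsv' _ hz' (hE.ne_zero_of_im_pos hz), norm_div, hεn, norm_pow]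
  have hb4' : ∀ z : ℂ, 0 < z.im → ‖w₀‖ + 1 ≤ ‖z‖ →
      ‖sharp (fun u => G (u + I)) z / E z‖ ≤ 1 / ‖z - conj w₀‖ ^ n := by
    intro z hz hR
    have hz' : z ≠ conj w₀ := by
      intro h
      rw [h, Complex.norm_conj] at hR
      linarith
    have hEz := hE.ne_zero_of_im_pos hz
    rw [hGssv _ hz', norm_div _ ((z - conj w₀) ^ n), norm_mul, Complex.norm_conj, hεn, one_mul,
      norm_pow]
    refine div_le_div_of_nonneg_right ?_ (by positivity)
    rw [norm_div, div_le_one (norm_pos_iff.2 hEz)]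
    exact hE.norm_sharp_le hz.le
  have hGsb := exists_joint_bound (E := E) (F := fun u => G (u + I))
    (exists_bound_of_le_inv_pow (H := fun u => G (u + I)) hn hb3')
    (exists_bound_of_le_inv_pow (H := sharp fun u => G (u + I)) hn hb4')
  exact ⟨Mem.of_bound hE hK hGd hG2 hGb, Mem.of_bound hE hK hGsd hGs2 hGsb⟩

/-! ### Theorem 6 -/

/-- **de Branges 1986, Theorem 6, with de Branges' strict kernel positivity** — for every
structure function with the reproducing property (in particular every `E` without real zeros):
under linear dependence of `E(· − i)`, `E♯` and the positivity condition on the shift domain,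
every zero `w` with `w, w + i ∉ ℝ` and `E(w + i) ≠ E(w − i)` is simple, lies on `w̄ = w + i`,
and `Re conj E′(w) E(w + i)/(2πi) > 0` (printed proof, p. 15 l. 2 – p. 16 l. 16: the form on
`K(w, ·)` equals `2 Re K(w, w + i)`; if it vanished, the Schwarz inequality would force
`F(w + i) = 0` on the whole shift domain, contradicting the divided-out element).
[cite: deBranges1986, Theorem 6] -/
theorem deBranges1986_thm6_of_hasReproducing (hE : IsHermiteBiehler E) (hK : HasReproducing E)
    (hlin : ShiftLinDep E) (hpos : ShiftNonneg E) {w : ℂ} (hw : IsAdmissibleZero E w) :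
    deriv E w ≠ 0 ∧ conj w = w + I ∧ 0 < (conj (deriv E w) * E (w + I) / (2 * π * I)).re := by
  obtain ⟨hw0, h0, h1, hne⟩ := hw
  obtain ⟨ε, hεn, hfe⟩ := hlin.exists_eps hE.apply_I_ne_zero
  obtain ⟨hneg, hgt⟩ := zero_mem_strip hE hfe hw0 h0 h1
  have hE1 : E (w + I) ≠ 0 := hE.ne_zero_of_im_pos (by simp only [add_im, Complex.I_im]; linarith)
  obtain ⟨K, hKD, -, -, hKeq, hKval, hinner, hpair⟩ :=
    exists_shiftMem_kernel hE hK hεn hfe hw0 h0 h1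
  obtain ⟨G, hGD, hG0⟩ := exists_shiftMem_apply_ne_zero hE hK hεn hfe hw0 h0 h1
  -- the form is strictly positive on `K`
  have hre : 0 < (deBrangesInner E (fun z => K (z + I)) K).re := by
    by_contra hle
    have h00 : (deBrangesInner E (fun z => K (z + I)) K).re = 0 :=
      le_antisymm (not_lt.1 hle) (hpos K hKD)
    have hS := shiftForm_eq_zero_of_re_eq_zero hE hK hpos hGD hKD h00
    rw [hpair G hGD] at hS
    rcases mul_eq_zero.1 hS with h | h
    · rw [div_eq_zero_iff] at h
      rcases h with h | h
      · exact hne (sub_eq_zero.1 h)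
      · exact hE1 h
    · exact hG0 h
  rw [hinner] at hre
  -- hence `K(w + i) ≠ 0`, so `w̄ = w + i`
  have hline : conj w = w + I := by
    by_contra hne'
    have hsE1 : sharp E (w + I) = 0 := by rw [hfe, add_sub_cancel_right, hw0, mul_zero]
    have : K (w + I) = 0 := by
      rw [hKeq _ (Ne.symm hne')]
      unfold deBrangesKernel
      rw [hw0, map_zero, mul_zero, hsE1, zero_mul, sub_zero, zero_div]
    rw [this] at hre
    simp at hre
  rw [← hline, hKval, hline] at hre
  refine ⟨fun hd => ?_, hline, hre⟩
  rw [hd, map_zero, zero_mul, zero_div] at hre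
  simp at hre

/-- **de Branges 1986, Theorem 6, for structure functions without real zeros** (the generality
of Conrey–Li's Theorem 1, WITHOUT its monotonicity hypothesis): the printed conclusion — every
admissible zero is simple and lies on `w̄ = w + i`. [cite: deBranges1986, Theorem 6] -/
theorem deBranges1986_thm6_of_noRealZeros (hE : IsHermiteBiehler E) (hreal : ∀ x : ℝ, E x ≠ 0)
    (hlin : ShiftLinDep E) (hpos : ShiftNonneg E) {w : ℂ} (hw : IsAdmissibleZero E w) :
    deriv E w ≠ 0 ∧ conj w = w + I :=
  let h := deBranges1986_thm6_of_hasReproducing hE (hasReproducing_of_noRealZeros hE hreal)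
    hlin hpos hw
  ⟨h.1, h.2.1⟩

/-- The printed statement `deBranges1986_thm6` follows from the reproducing property of every
structure function satisfying its hypotheses (the remaining input for structure functions with
real zeros). [cite: deBranges1986, Theorem 6] -/
theorem deBranges1986_thm6_of_forall_hasReproducing
    (H : ∀ E : ℂ → ℂ, IsHermiteBiehler E → ShiftLinDep E → HasReproducing E) :
    deBranges1986_thm6 := fun E hE hlin hpos _ hw =>
  let h := deBranges1986_thm6_of_hasReproducing hE (H E hE hlin) hlin hpos hw
  ⟨h.1, h.2.1⟩


/-! ### The strict form of Theorem 6 (p. 16, l. 17–20) -/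

/-- The paired zero: `E(w) = 0` implies `E(w̄ − i) = 0` under the functional identity.
[cite: deBranges1986, p. 14] -/
theorem paired_zero {ε : ℂ} (hfe : ∀ z : ℂ, sharp E z = ε * E (z - I)) {w : ℂ} (hw : E w = 0) :
    E (conj w - I) = 0 := by
  have h3 : sharp E (w + I) = 0 := by rw [hfe, add_sub_cancel_right, hw, mul_zero]
  rw [sharp_apply, map_eq_zero, map_add, Complex.conj_I, ← sub_eq_add_neg] at h3
  exact h3

/-- **Strict positivity excludes the zeros with `E(w + i) = E(w − i)`** (the provable clause of
de Branges' remark p. 16 l. 17–20, for every structure function with the reproducing property):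
at such a zero the form vanishes identically against `K(w, ·)`, a nonzero element of the shift
domain, so `Re (K(t + i), K(t)) = 0`. [cite: deBranges1986, p. 16] -/
theorem apply_add_I_ne_of_shiftPos (hE : IsHermiteBiehler E) (hK : HasReproducing E)
    (hlin : ShiftLinDep E) (hpos : ShiftPos E) {w : ℂ} (hw : E w = 0) (h0 : w.im ≠ 0)
    (h1 : (w + I).im ≠ 0) : E (w + I) ≠ E (w - I) := by
  intro heq
  obtain ⟨ε, hεn, hfe⟩ := hlin.exists_eps hE.apply_I_ne_zero
  obtain ⟨K, hKD, hK0, -, -, -, -, hpair⟩ := exists_shiftMem_kernel hE hK hεn hfe hw h0 h1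
  have h := hpos K hKD hK0
  have hS : shiftForm E K K = 0 := by rw [hpair K hKD, heq, sub_self, zero_div, zero_mul]
  have h2 := shiftForm_self_re (E := E) K
  rw [hS, Complex.zero_re] at h2
  linarith

/-- **de Branges' strict remark (p. 16, l. 17–20) for structure functions without real zeros**:
under linear dependence and STRICT positivity on the shift domain every zero of `E` is
admissible (`w, w + i ∉ ℝ` because `E` and hence, by the pairing `w ↦ w̄ − i`, `E(· − i)` have
no real zeros; `E(w + i) ≠ E(w − i)` by `apply_add_I_ne_of_shiftPos`) — hence, with Theorem 6,
simple and on `Im w = −1/2`. [cite: deBranges1986, p. 16] -/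
theorem deBranges1986_strictRemark_of_noRealZeros (hE : IsHermiteBiehler E)
    (hreal : ∀ x : ℝ, E x ≠ 0) (hlin : ShiftLinDep E) (hpos : ShiftPos E) {w : ℂ}
    (hw : E w = 0) : IsAdmissibleZero E w := by
  obtain ⟨ε, -, hfe⟩ := hlin.exists_eps hE.apply_I_ne_zero
  have h0 : w.im ≠ 0 := by
    intro h
    have : w = (w.re : ℂ) := Complex.ext (by simp) (by simp [h])
    exact hreal w.re (this ▸ hw)
  have h1 : (w + I).im ≠ 0 := by
    intro h
    have him : (conj w - I).im = 0 := by
      simp only [sub_im, Complex.conj_im, Complex.I_im]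
      simp only [add_im, Complex.I_im] at h
      linarith
    have hz := paired_zero hfe hw
    have : conj w - I = ((conj w - I).re : ℂ) := Complex.ext (by simp) (by rw [him]; simp)
    exact hreal _ (this ▸ hz)
  exact ⟨hw, h0, h1,
    apply_add_I_ne_of_shiftPos hE (hasReproducing_of_noRealZeros hE hreal) hlin hpos hw h0 h1⟩

/-- All zeros simple and on the line under strict positivity (no real zeros): the remark
combined with Theorem 6. [cite: deBranges1986, p. 16] -/
theorem zeros_simple_on_line_of_shiftPos (hE : IsHermiteBiehler E) (hreal : ∀ x : ℝ, E x ≠ 0)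
    (hlin : ShiftLinDep E) (hpos : ShiftPos E) {w : ℂ} (hw : E w = 0) :
    deriv E w ≠ 0 ∧ conj w = w + I :=
  deBranges1986_thm6_of_noRealZeros hE hreal hlin hpos.shiftNonneg
    (deBranges1986_strictRemark_of_noRealZeros hE hreal hlin hpos hw)

/-! ### Theorem 7 -/

/-- Measurability on `ℝ` of `x ↦ G(x)/E(x)` for `G` continuous on `ℝ` (used for the
generators `E(z)/(z − w)`, which are continuous on `ℝ` for `w ∉ ℝ`). [folklore] -/
private theorem aestronglyMeasurable_div_of_continuous (hd : Differentiable ℂ E) {G : ℂ → ℂ}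
    (hG : Continuous fun x : ℝ => G x) : AEStronglyMeasurable (fun x : ℝ => G x / E x) volume :=
  (hG.measurable.div (hd.continuous.measurable.comp Complex.measurable_ofReal)).aestronglyMeasurable

/-- The generator `z ↦ E(z)/(z − w)` is continuous on `ℝ` for `w ∉ ℝ`. [cite: deBranges1986,
Theorem 7] -/
theorem continuous_generator (hd : Differentiable ℂ E) {w : ℂ} (hw : w.im ≠ 0) :
    Continuous fun x : ℝ => E x / ((x : ℂ) - w) := by
  refine (hd.continuous.comp Complex.continuous_ofReal).div
    (Complex.continuous_ofReal.sub continuous_const) fun x h => hw ?_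
  have := congrArg Complex.im h
  simpa using this

/-- The generator divided by `E` is square integrable on `ℝ`: `|E(x)/(x − w)/E(x)| ≤ 1/|x − w|`
(`= 0` at real zeros of `E`). [cite: deBranges1986, Theorem 7] -/
theorem integrable_sq_generator (hd : Differentiable ℂ E) {w : ℂ} (hw : w.im ≠ 0) :
    Integrable fun x : ℝ => ‖(E x / ((x : ℂ) - w)) / E x‖ ^ 2 := by
  refine integrable_sq_of_le_inv_pow (E := E) (H := fun z => E z / (z - w)) (p := w) hw
    (n := 1) le_rfl
    (aestronglyMeasurable_div_of_continuous hd (G := fun z => E z / (z - w))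
      (continuous_generator hd hw))
    fun x => ?_
  by_cases hEx : E x = 0
  · simp only [hEx, zero_div, norm_zero]
    positivity
  · rw [div_right_comm, div_self hEx, pow_one, norm_div, norm_one]

/-- `(F, Σ_i a_i G_i) = Σ_i conj a_i (F, G_i)` (finite sums, each pairing integrable).
[cite: deBranges1986, Theorem 7] -/
theorem deBrangesInner_finset_sum_right {ι : Type*} (s : Finset ι) (a : ι → ℂ) (G : ι → ℂ → ℂ)
    (F : ℂ → ℂ) (hint : ∀ i ∈ s, Integrable fun x : ℝ => F x * conj (G i x) / ((‖E x‖ : ℂ) ^ 2)) :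
    deBrangesInner E F (fun z => ∑ i ∈ s, a i * G i z) =
      ∑ i ∈ s, conj (a i) * deBrangesInner E F (G i) := by
  unfold deBrangesInner
  have h : ∀ x : ℝ, F x * conj (∑ i ∈ s, a i * G i x) / ((‖E x‖ : ℂ) ^ 2) =
      ∑ i ∈ s, conj (a i) * (F x * conj (G i x) / ((‖E x‖ : ℂ) ^ 2)) := by
    intro x
    rw [map_sum, Finset.mul_sum, Finset.sum_div]
    refine Finset.sum_congr rfl fun i _ => ?_
    rw [map_mul]
    ring
  simp_rw [h]
  rw [integral_finsetSum _ fun i hi => (hint i hi).const_mul _]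
  refine Finset.sum_congr rfl fun i _ => ?_
  exact MeasureTheory.integral_const_mul _ _

/-- `(F, G₁ − G₂) = (F, G₁) − (F, G₂)` (both pairings integrable). [cite: deBranges1986,
Theorem 7] -/
theorem deBrangesInner_sub_right {F G₁ G₂ : ℂ → ℂ}
    (h₁ : Integrable fun x : ℝ => F x * conj (G₁ x) / ((‖E x‖ : ℂ) ^ 2))
    (h₂ : Integrable fun x : ℝ => F x * conj (G₂ x) / ((‖E x‖ : ℂ) ^ 2)) :
    deBrangesInner E F (fun z => G₁ z - G₂ z) = deBrangesInner E F G₁ - deBrangesInner E F G₂ := by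
  unfold deBrangesInner
  rw [← integral_sub h₁ h₂]
  refine integral_congr_ae (ae_of_all _ fun x => ?_)
  simp only [map_sub]
  ring

/-- Square integrability of `(F − Σ a_w E(·)/(· − w))/E` for `F/E ∈ L²` and non-real `w`'s.
[cite: deBranges1986, Theorem 7] -/
theorem integrable_sq_sub_sum (hd : Differentiable ℂ E) {F : ℂ → ℂ} (hF : Differentiable ℂ F)
    (hF2 : Integrable fun x : ℝ => ‖F x / E x‖ ^ 2) (s : Finset ℂ) (a : ℂ → ℂ)
    (hs : ∀ w ∈ s, w.im ≠ 0) :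
    Integrable fun x : ℝ => ‖(F x - ∑ w ∈ s, a w * (E x / ((x : ℂ) - w))) / E x‖ ^ 2 := by
  induction s using Finset.induction_on with
  | empty => simpa using hF2
  | insert w s hws ih =>
    have hs' : ∀ w' ∈ s, w'.im ≠ 0 := fun w' hw' => hs w' (Finset.mem_insert_of_mem hw')
    have hw : w.im ≠ 0 := hs w (Finset.mem_insert_self w s)
    have hcont : Continuous fun x : ℝ => F x - ∑ w' ∈ s, a w' * (E x / ((x : ℂ) - w')) := by
      refine (hF.continuous.comp Complex.continuous_ofReal).sub ?_
      refine continuous_finsetSum s fun w' hw' => ?_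
      exact continuous_const.mul (continuous_generator hd (hs' w' hw'))
    have h := integrable_sq_add_mul (E := E)
      (F := fun z => F z - ∑ w' ∈ s, a w' * (E z / (z - w'))) (G := fun z => E z / (z - w))
      (-a w)
      (aestronglyMeasurable_div_of_continuous hd
        (G := fun z => F z - ∑ w' ∈ s, a w' * (E z / (z - w'))) hcont)
      (aestronglyMeasurable_div_of_continuous hd (G := fun z => E z / (z - w))
        (continuous_generator hd hw))
      (ih hs') (integrable_sq_generator hd hw)
    refine h.congr (ae_of_all _ fun x => ?_)
    have e : F x - ∑ w' ∈ s, a w' * (E x / ((x : ℂ) - w')) + -a w * (E x / ((x : ℂ) - w)) =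
        F x - ∑ w' ∈ insert w s, a w' * (E x / ((x : ℂ) - w')) := by
      rw [Finset.sum_insert hws]
      ring
    exact congrArg (fun u : ℂ => ‖u / E (x : ℂ)‖ ^ 2) e

/-- **de Branges 1986, Theorem 7** — for every structure function with the reproducing property
(in particular every `E` without real zeros): under linear dependence, the positivity condition
and density of the span of the functions `E(z)/(z − w)` (`w` admissible zeros), the form is
strictly positive on nonzero elements of the shift domain. Printed proof (p. 16, l. 33–43): if
`Re (F(t + i), F(t)) = 0` then `F(w + i) = 0` at every admissible `w` by the Schwarz step of
Theorem 6, i.e. `F ⊥ K(w + i, ·) = −conj E(w + i)/(2πi) · E(z)/(z − w)` (using `w̄ = w + i`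
from Theorem 6), so `F ⊥` the closed span, `‖F‖ = 0`, `F = 0`. [cite: deBranges1986,
Theorem 7] -/
theorem deBranges1986_thm7_of_hasReproducing (hE : IsHermiteBiehler E) (hK : HasReproducing E)
    (hlin : ShiftLinDep E) (hpos : ShiftNonneg E) (hspan : ∀ F : ℂ → ℂ, Mem E F → InClosedSpan E F) :
    ShiftPos E := by
  intro F hF hF0
  have hd := hE.differentiable
  obtain ⟨ε, hεn, hfe⟩ := hlin.exists_eps hE.apply_I_ne_zero
  rcases (hpos F hF).lt_or_eq with hlt | heq
  · exact hlt
  exfalso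
  have h00 : (deBrangesInner E (fun z => F (z + I)) F).re = 0 := heq.symm
  -- Step 1: `F(w + i) = 0` at every admissible zero
  have hvan : ∀ w : ℂ, IsAdmissibleZero E w → F (w + I) = 0 := by
    intro w hw
    obtain ⟨hw0, h0, h1, hne⟩ := hw
    obtain ⟨hneg, hgt⟩ := zero_mem_strip hE hfe hw0 h0 h1
    have hE1 : E (w + I) ≠ 0 :=
      hE.ne_zero_of_im_pos (by simp only [add_im, Complex.I_im]; linarith)
    obtain ⟨K, hKD, -, -, -, -, -, hpair⟩ := exists_shiftMem_kernel hE hK hεn hfe hw0 h0 h1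
    have hS : shiftForm E K F = 0 := shiftForm_eq_zero_of_re_eq_zero hE hK hpos hKD hF h00
    have hS' : shiftForm E F K = 0 := by
      rw [shiftForm_conj_symm (E := E) K F, hS, map_zero]
    rw [hpair F hF] at hS'
    rcases mul_eq_zero.1 hS' with h | h
    · exfalso
      rw [div_eq_zero_iff] at h
      rcases h with h | h
      · exact hne (sub_eq_zero.1 h)
      · exact hE1 h
    · exact h
  -- Step 2: `F ⊥ E(z)/(z − w)` for every admissible zero `w`
  have horth : ∀ w : ℂ, IsAdmissibleZero E w →
      deBrangesInner E F (fun z => E z / (z - w)) = 0 := by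
    intro w hw
    have hline := (deBranges1986_thm6_of_hasReproducing hE hK hlin hpos hw).2.1
    obtain ⟨hw0, h0, h1, hne⟩ := hw
    obtain ⟨hneg, hgt⟩ := zero_mem_strip hE hfe hw0 h0 h1
    have hE1 : E (w + I) ≠ 0 :=
      hE.ne_zero_of_im_pos (by simp only [add_im, Complex.I_im]; linarith)
    have hE1' : conj (E (w + I)) ≠ 0 := (map_ne_zero _).2 hE1
    have hsE1 : sharp E (w + I) = 0 := by rw [hfe, add_sub_cancel_right, hw0, mul_zero]
    have hπ : (2 * π * I : ℂ) ≠ 0 := by simp [Real.pi_ne_zero]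
    obtain ⟨K₁, -, -, -, hK₁x, -⟩ := exists_kernel_mem hE hK h1
    set κ : ℂ := -(2 * π * I) / conj (E (w + I)) with hκ
    have hcw : conj (w + I) = w := by
      rw [map_add, Complex.conj_I, hline]
      ring
    have hgen : ∀ x : ℝ, E x / ((x : ℂ) - w) = κ * deBrangesKernel E (w + I) x := by
      intro x
      have hxw : (x : ℂ) - w ≠ 0 := by
        intro h
        have := congrArg Complex.im h
        simp only [sub_im, ofReal_im, zero_im] at this
        exact h0 (by linarith)
      have hwx : w - (x : ℂ) ≠ 0 := fun h => hxw (by rw [← neg_sub, h, neg_zero])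
      unfold deBrangesKernel
      rw [hsE1, map_zero, mul_zero, sub_zero, hcw, hκ]
      field_simp
      ring
    calc deBrangesInner E F (fun z => E z / (z - w))
        = deBrangesInner E F (fun z => κ * K₁ z) :=
          deBrangesInner_congr_right fun x => by rw [hgen, hK₁x]
      _ = conj κ * deBrangesInner E F K₁ := deBrangesInner_const_mul_right _ _ _
      _ = conj κ * deBrangesInner E F (deBrangesKernel E (w + I)) := by
          rw [deBrangesInner_congr_right hK₁x]
      _ = conj κ * F (w + I) := by rw [hF.1.inner_kernel hE hK h1]
      _ = 0 := by rw [hvan w ⟨hw0, h0, h1, hne⟩, mul_zero]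
  -- Step 3: `‖F‖ = 0`
  have hN0 : 0 ≤ deBrangesNormSq E F := deBrangesNormSq_nonneg E F
  have hN : deBrangesNormSq E F = 0 := by
    by_contra hN
    have hNpos : 0 < deBrangesNormSq E F := lt_of_le_of_ne hN0 (Ne.symm hN)
    obtain ⟨s, a, hs, hδ⟩ := hspan F hF.1 (deBrangesNormSq E F / 2) (by positivity)
    have hs' : ∀ w ∈ s, w.im ≠ 0 := fun w hw => (hs w hw).2.1
    have hFm : AEStronglyMeasurable (fun x : ℝ => F x / E x) volume :=
      aestronglyMeasurable_div_of_differentiable hd hF.1.differentiable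
    have hF2 : Integrable fun x : ℝ => ‖F x / E x‖ ^ 2 := hF.1.integrable_sq
    -- the pairings with the generators are integrable and vanish
    have hint : ∀ w ∈ s, Integrable fun x : ℝ =>
        F x * conj (E x / ((x : ℂ) - w)) / ((‖E x‖ : ℂ) ^ 2) := fun w hw =>
      integrable_inner_integrand' (E := E) (F := F) (G := fun z => E z / (z - w)) hFm
        (aestronglyMeasurable_div_of_continuous hd (G := fun z => E z / (z - w))
          (continuous_generator hd (hs' w hw)))
        hF2 (integrable_sq_generator hd (hs' w hw))
    have hFL : deBrangesInner E F (fun z => ∑ w ∈ s, a w * (E z / (z - w))) = 0 := by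
      rw [deBrangesInner_finset_sum_right (E := E) s a (fun w z => E z / (z - w)) F hint]
      refine Finset.sum_eq_zero fun w hw => ?_
      rw [horth w (hs w hw), mul_zero]
    have hFF : Integrable fun x : ℝ => F x * conj (F x) / ((‖E x‖ : ℂ) ^ 2) :=
      integrable_inner_integrand' (E := E) (F := F) (G := F) hFm hFm hF2 hF2
    have hFLi : Integrable fun x : ℝ =>
        F x * conj (∑ w ∈ s, a w * (E x / ((x : ℂ) - w))) / ((‖E x‖ : ℂ) ^ 2) := by
      have h : ∀ x : ℝ, F x * conj (∑ w ∈ s, a w * (E x / ((x : ℂ) - w))) / ((‖E x‖ : ℂ) ^ 2)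
          = ∑ w ∈ s, conj (a w) * (F x * conj (E x / ((x : ℂ) - w)) / ((‖E x‖ : ℂ) ^ 2)) := by
        intro x
        rw [map_sum, Finset.mul_sum, Finset.sum_div]
        refine Finset.sum_congr rfl fun i _ => ?_
        rw [map_mul]
        ring
      simp_rw [h]
      exact integrable_finsetSum _ fun w hw => (hint w hw).const_mul _
    -- `(F, F − L) = ‖F‖²`
    have h1 : deBrangesInner E F (fun z => F z - ∑ w ∈ s, a w * (E z / (z - w))) =
        (deBrangesNormSq E F : ℂ) := by
      rw [deBrangesInner_sub_right (E := E) (F := F) (G₁ := F)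
        (G₂ := fun z => ∑ w ∈ s, a w * (E z / (z - w))) hFF hFLi, hFL, sub_zero,
        deBrangesInner_self]
    -- Cauchy–Schwarz: `‖F‖² ≤ √(‖F‖² · ‖F − L‖²) ≤ √(‖F‖² · ‖F‖²/2)`
    have hDm : AEStronglyMeasurable
        (fun x : ℝ => (F x - ∑ w ∈ s, a w * (E x / ((x : ℂ) - w))) / E x) volume := by
      refine aestronglyMeasurable_div_of_continuous hd
        (G := fun z => F z - ∑ w ∈ s, a w * (E z / (z - w))) ?_
      refine (hF.1.differentiable.continuous.comp Complex.continuous_ofReal).sub ?_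
      exact continuous_finsetSum s fun w hw =>
        continuous_const.mul (continuous_generator hd (hs' w hw))
    have hD2 := integrable_sq_sub_sum hd hF.1.differentiable hF2 s a hs'
    have hCS := re_deBrangesInner_le_sqrt (E := E) (F := F)
      (G := fun z => F z - ∑ w ∈ s, a w * (E z / (z - w))) hFm hDm hF2 hD2
    rw [h1, Complex.ofReal_re] at hCS
    have h2 : deBrangesNormSq E F *
        deBrangesNormSq E (fun z => F z - ∑ w ∈ s, a w * (E z / (z - w))) ≤
        deBrangesNormSq E F * (deBrangesNormSq E F / 2) := mul_le_mul_of_nonneg_left hδ.le hN0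
    have h3 : deBrangesNormSq E F ≤ √(deBrangesNormSq E F * (deBrangesNormSq E F / 2)) :=
      hCS.trans (Real.sqrt_le_sqrt h2)
    have h4 : deBrangesNormSq E F ^ 2 ≤ deBrangesNormSq E F * (deBrangesNormSq E F / 2) := by
      have := pow_le_pow_left₀ hN0 h3 2
      rwa [Real.sq_sqrt (by positivity)] at this
    nlinarith
  exact hF0 (hF.1.eq_zero_of_normSq_eq_zero hN)

/-- **de Branges 1986, Theorem 7, for structure functions without real zeros.**
[cite: deBranges1986, Theorem 7] -/
theorem deBranges1986_thm7_of_noRealZeros (hE : IsHermiteBiehler E) (hreal : ∀ x : ℝ, E x ≠ 0)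
    (hlin : ShiftLinDep E) (hpos : ShiftNonneg E)
    (hspan : ∀ F : ℂ → ℂ, Mem E F → InClosedSpan E F) : ShiftPos E :=
  deBranges1986_thm7_of_hasReproducing hE (hasReproducing_of_noRealZeros hE hreal) hlin hpos hspan

/-- The printed statement `deBranges1986_thm7` follows from the reproducing property of every
structure function satisfying its hypotheses. [cite: deBranges1986, Theorem 7] -/
theorem deBranges1986_thm7_of_forall_hasReproducing
    (H : ∀ E : ℂ → ℂ, IsHermiteBiehler E → ShiftLinDep E → HasReproducing E) :
    deBranges1986_thm7 := fun E hE hlin hpos hspan =>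
  deBranges1986_thm7_of_hasReproducing hE (H E hE hlin) hlin hpos hspan

end Literature.Analysis.DeBrangesSpaces

end
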